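import Summits.Ventures.WeilGRH.TwistedColumns
import Summits.RiemannHypothesis.RiemannHypothesis.Theorems.WeilFormatCColumnKernel
import HarnessLib

/-!
# GRH arm (rh-explicit, venture WeilGRH): twisted format C, L-C3b at EVERY order — the exact Cauchy structure of the
  far columns of `twistedGramCoeff χ a` and the order-`J` remainder

Cell `rh-explicit`, WEIL TRACK — GRH ARM (lit/typing seat weil-grh-5 gen11).  The twist of weil-10's
`WeilFormatCColumnKernel.lean` (ζ) to the χ-Gram kernel `twistedGramCoeff χ a` of `TwistedGramEvenReal.lean` (any χ;
the kernel carries `Re χ(k)` prime weights, NO pole term, and the conductor `(log q)δ` has no off-diagonal entries).  With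
the TWISTED MODE FUNCTION

`F^χ_n := ½·Im ψ(¼ + iω_n/2) + Σ_k Re χ(k) (Λ_k/√k) sin(ω_n log k) − T_n` (`T_n = archExpSumSin a n`, `ω_n = πn/a`),

the coupling columns of the SectorSplit kernels `M^±` of `twistedGramCoeff χ a` have the exact ONE-TERM Cauchy structure

* `evenTwistedKernel_col_eq` — `M⁺_χ(i,m) = (−1)^{i+m}(mF^χ_m − iF^χ_i)/(π(m² − i²))` for `0 ≤ i < m`;
* `oddTwistedKernel_col_eq` — `M⁻_χ(i,m) = (−1)^{i+m}(iF^χ_m − mF^χ_i)/(π(m² − i²))` for `1 ≤ i < m` (modes);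
* `abs_twistedModeF_le` — `|F^χ_n| ≤ C_F := π/4 + ΛΣ + a(1+E)/π` (`|Re χ(k)| ≤ 1`; the ζ constant);
* `abs_evenTwistedKernel_col_sub_sum_le`, `abs_oddTwistedKernel_col_sub_sum_le` — for every `J`, on `2i ≤ m`:
  `|M⁺_χ(i,m) − (−1)^{i+m}Σ_{j<J}(F^χ_m i^{2j}/(πm^{2j+1}) − F^χ_i i^{2j+1}/(πm^{2j+2}))| ≤ 2C_F i^{2J}/(π m^{2J+1})`
  and the odd analogue with `Σ_{j<J}(F^χ_m i^{2j+1}/(πm^{2j+2}) − F^χ_i i^{2j}/(πm^{2j+1}))`.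

= weil-10's `evenKernel_col_eq` / `oddKernel_col_eq` / `abs_modeF_le` / `abs_even/oddKernel_col_sub_sum_le` with the polar
term `(4s²/a)c_ic_m` (resp. `−(16s²/a)d_id_m`) DELETED and the prime rows re-weighted; the expansion/remainder algebra
(`even/odd_expansion_term`, `col_remainder_core`, `abs_inv_sq_sub_sq_sub_sum_le`) is weil-10's, used verbatim.  So the
structured tail of the twisted L-C3b has rank `2J` at order `J` (one rank fewer than ζ's), remainder `(i/m)^{2J}/m`.
No definitions; no named facts; RH/GRH-free; standard axioms.
-/

set_option autoImplicit false

noncomputable section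

open Complex Finset
open scoped Real BigOperators ArithmeticFunction.vonMangoldt

namespace Summit.Ventures.WeilGRH

open Literature.NumberTheory.LFunctions
open Literature.NumberTheory.LFunctions.Yoshida1992 (freq incrCoeff archCoeff archExpSumSin)
open Literature.Analysis.SpecialFunctions
open Summit.RiemannHypothesis.RiemannHypothesis.Theorems.WeilFormatC

variable {q : ℕ} {a : ℝ}

/-! ## The exact column structure -/

section Structure

/-- **Even column structure (twisted).**  For `1 ≤ m`, `i < m` (`i = 0` allowed):
`M⁺_χ(i,m) = (−1)^{i+m}(m F^χ_m − i F^χ_i)/(π(m² − i²))`. -/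
theorem evenTwistedKernel_col_eq (χ : DirichletCharacter ℂ q) (a : ℝ) {i m : ℕ} (hm : 1 ≤ m) (him : i < m) :
    (if i = 0 then twistedGramCoeff χ a 0 m else if m = 0 then twistedGramCoeff χ a i 0
        else (twistedGramCoeff χ a i m + twistedGramCoeff χ a i (-(m : ℤ))) / 2)
      = (-1 : ℝ) ^ ((i : ℤ) + m) *
        (((m : ℝ) * ((Complex.digamma (1 / 4 + ((freq a m : ℝ) : ℂ) / 2 * I)).im / 2
              + (∑ k ∈ weilPrimeIndex a,
                  (χ (k : ZMod q)).re * ((Λ k : ℝ) / Real.sqrt k) * Real.sin (freq a m * Real.log k))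
              - archExpSumSin a m)
            - i * ((Complex.digamma (1 / 4 + ((freq a i : ℝ) : ℂ) / 2 * I)).im / 2
              + (∑ k ∈ weilPrimeIndex a,
                  (χ (k : ZMod q)).re * ((Λ k : ℝ) / Real.sqrt k) * Real.sin (freq a i * Real.log k))
              - archExpSumSin a i))
          / (π * ((m : ℝ) ^ 2 - i ^ 2))) := by
  have h1 : (i : ℤ) ≠ m := by exact_mod_cast (ne_of_lt him)
  have h2 : (i : ℤ) ≠ -(m : ℤ) := by omega
  have h0m : (0 : ℤ) ≠ m := by exact_mod_cast (show (0 : ℕ) ≠ m by omega)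
  -- split the kernel column: twisted prime + arch (the conductor has no off-diagonal entries)
  have hsplit : (if i = 0 then twistedGramCoeff χ a 0 m else if m = 0 then twistedGramCoeff χ a i 0
        else (twistedGramCoeff χ a i m + twistedGramCoeff χ a i (-(m : ℤ))) / 2)
      = (if i = 0 then (∑ k ∈ weilPrimeIndex a, (χ (k : ZMod q)).re * ((Λ k : ℝ) / Real.sqrt k) *
            (incrCoeff a (Real.log k) 0 m - if (0 : ℤ) = m then 2 else 0))
          else if m = 0 then (∑ k ∈ weilPrimeIndex a, (χ (k : ZMod q)).re * ((Λ k : ℝ) / Real.sqrt k) *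
            (incrCoeff a (Real.log k) i 0 - if (i : ℤ) = 0 then 2 else 0))
          else ((∑ k ∈ weilPrimeIndex a, (χ (k : ZMod q)).re * ((Λ k : ℝ) / Real.sqrt k) *
            (incrCoeff a (Real.log k) i m - if (i : ℤ) = m then 2 else 0)) +
            (∑ k ∈ weilPrimeIndex a, (χ (k : ZMod q)).re * ((Λ k : ℝ) / Real.sqrt k) *
            (incrCoeff a (Real.log k) i (-(m : ℤ)) - if (i : ℤ) = -(m : ℤ) then 2 else 0))) / 2)
        + (if i = 0 then archCoeff a 0 m else if m = 0 then archCoeff a i 0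
          else (archCoeff a i m + archCoeff a i (-(m : ℤ))) / 2) := by
    by_cases hi : i = 0
    · subst hi
      simp only [if_true]
      rw [twistedGramCoeff_eq_arch_add_prime_add_conductor]
      simp only [if_neg h0m]
      ring
    · have hm' : m ≠ 0 := by omega
      simp only [if_neg hi, if_neg hm']
      rw [twistedGramCoeff_eq_arch_add_prime_add_conductor, twistedGramCoeff_eq_arch_add_prime_add_conductor]
      simp only [if_neg h1, if_neg h2]
      ring
  rw [hsplit, evenTwistedPrime_col_eq (fun k : ℕ ↦ (χ (k : ZMod q)).re) a hm him, evenArch_col_eq a hm him,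
    sum_mul_sub_div_eq]
  have hd1' : (m : ℝ) - i ≠ 0 := sub_ne_zero.mpr (by exact_mod_cast (ne_of_gt him))
  have hD : (m : ℝ) ^ 2 - i ^ 2 ≠ 0 := by rw [sq_sub_sq]; exact mul_ne_zero (by positivity) hd1'
  field_simp
  ring

/-- **Odd column structure (twisted).**  For `1 ≤ i < m` (modes):
`M⁻_χ(i,m) = (−1)^{i+m}(i F^χ_m − m F^χ_i)/(π(m² − i²))`. -/
theorem oddTwistedKernel_col_eq (χ : DirichletCharacter ℂ q) (a : ℝ) {i m : ℕ} (hi : 1 ≤ i) (him : i < m) :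
    (twistedGramCoeff χ a i m - twistedGramCoeff χ a i (-(m : ℤ))) / 2
      = (-1 : ℝ) ^ ((i : ℤ) + m) *
        (((i : ℝ) * ((Complex.digamma (1 / 4 + ((freq a m : ℝ) : ℂ) / 2 * I)).im / 2
              + (∑ k ∈ weilPrimeIndex a,
                  (χ (k : ZMod q)).re * ((Λ k : ℝ) / Real.sqrt k) * Real.sin (freq a m * Real.log k))
              - archExpSumSin a m)
            - m * ((Complex.digamma (1 / 4 + ((freq a i : ℝ) : ℂ) / 2 * I)).im / 2
              + (∑ k ∈ weilPrimeIndex a,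
                  (χ (k : ZMod q)).re * ((Λ k : ℝ) / Real.sqrt k) * Real.sin (freq a i * Real.log k))
              - archExpSumSin a i))
          / (π * ((m : ℝ) ^ 2 - i ^ 2))) := by
  have hm : 1 ≤ m := le_trans hi (le_of_lt him)
  have h1 : (i : ℤ) ≠ m := by exact_mod_cast (ne_of_lt him)
  have h2 : (i : ℤ) ≠ -(m : ℤ) := by omega
  have hsplit : (twistedGramCoeff χ a i m - twistedGramCoeff χ a i (-(m : ℤ))) / 2
      = ((∑ k ∈ weilPrimeIndex a, (χ (k : ZMod q)).re * ((Λ k : ℝ) / Real.sqrt k) *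
            (incrCoeff a (Real.log k) i m - if (i : ℤ) = m then 2 else 0)) -
          (∑ k ∈ weilPrimeIndex a, (χ (k : ZMod q)).re * ((Λ k : ℝ) / Real.sqrt k) *
            (incrCoeff a (Real.log k) i (-(m : ℤ)) - if (i : ℤ) = -(m : ℤ) then 2 else 0))) / 2
        + (archCoeff a i m - archCoeff a i (-(m : ℤ))) / 2 := by
    rw [twistedGramCoeff_eq_arch_add_prime_add_conductor, twistedGramCoeff_eq_arch_add_prime_add_conductor]
    simp only [if_neg h1, if_neg h2]
    ring
  rw [hsplit, oddTwistedPrime_col_eq (fun k : ℕ ↦ (χ (k : ZMod q)).re) a hi him,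
    oddArch_offDiag_eq a hi hm (ne_of_lt him), sum_mul_sub_div_eq]
  have hd1' : (m : ℝ) - i ≠ 0 := sub_ne_zero.mpr (by exact_mod_cast (ne_of_gt him))
  have hD : (m : ℝ) ^ 2 - i ^ 2 ≠ 0 := by rw [sq_sub_sq]; exact mul_ne_zero (by positivity) hd1'
  have hD' : (i : ℝ) ^ 2 - m ^ 2 ≠ 0 := by
    rw [show (i : ℝ) ^ 2 - m ^ 2 = -((m : ℝ) ^ 2 - i ^ 2) by ring]; exact neg_ne_zero.mpr hD
  field_simp
  ring

end Structure

/-! ## The size of the twisted mode function `F^χ_n` -/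

section ModeF

/-- **`|F^χ_n| ≤ C_F`** for every `n : ℕ`, `a > 0`: `|½Y_n + P^χ_n − T_n| ≤ π/4 + ΛΣ + a(1+E)/π`
(`|Re χ(k)| ≤ 1`, so the ζ constant of `WeilFormatC.abs_modeF_le` serves). -/
theorem abs_twistedModeF_le (χ : DirichletCharacter ℂ q) (ha : 0 < a) (n : ℕ) :
    |(Complex.digamma (1 / 4 + ((freq a n : ℝ) : ℂ) / 2 * I)).im / 2
        + (∑ k ∈ weilPrimeIndex a, (χ (k : ZMod q)).re * ((Λ k : ℝ) / Real.sqrt k) * Real.sin (freq a n * Real.log k))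
        - archExpSumSin a n|
      ≤ π / 4 + (∑ k ∈ weilPrimeIndex a, (Λ k : ℝ) / Real.sqrt k) + a * (1 + weilArchDensity (2 * a)) / π := by
  have hE0 : 0 < weilArchDensity (2 * a) := weilArchDensity_pos (by positivity)
  have hL : 0 ≤ ∑ k ∈ weilPrimeIndex a, (Λ k : ℝ) / Real.sqrt k :=
    Finset.sum_nonneg fun k _ ↦ div_nonneg ArithmeticFunction.vonMangoldt_nonneg (Real.sqrt_nonneg _)
  have hP : |∑ k ∈ weilPrimeIndex a, (χ (k : ZMod q)).re * ((Λ k : ℝ) / Real.sqrt k) * Real.sin (freq a n * Real.log k)|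
      ≤ ∑ k ∈ weilPrimeIndex a, (Λ k : ℝ) / Real.sqrt k := by
    refine (Finset.abs_sum_le_sum_abs _ _).trans (Finset.sum_le_sum fun k _ ↦ ?_)
    have hw : 0 ≤ (Λ k : ℝ) / Real.sqrt k := div_nonneg ArithmeticFunction.vonMangoldt_nonneg (Real.sqrt_nonneg _)
    rw [abs_mul, abs_mul, abs_of_nonneg hw]
    calc |(χ (k : ZMod q)).re| * ((Λ k : ℝ) / Real.sqrt k) * |Real.sin (freq a n * Real.log k)|
        ≤ 1 * ((Λ k : ℝ) / Real.sqrt k) * 1 :=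
          mul_le_mul (mul_le_mul_of_nonneg_right (abs_re_apply_le_one χ k) hw) (Real.abs_sin_le_one _)
            (abs_nonneg _) (by positivity)
      _ = _ := by ring
  rcases Nat.eq_zero_or_pos n with h0 | hn
  · subst h0
    simp only [CharP.cast_eq_zero]
    rw [im_digamma_quarter_zero, archExpSumSin_zero, freq_zero]
    simp only [zero_mul, Real.sin_zero, mul_zero, Finset.sum_const_zero, zero_div, zero_add, sub_zero, abs_zero]
    positivity
  have hn1 : 1 ≤ n := hn
  have hn0 : (0 : ℝ) < n := by exact_mod_cast hn1
  have hY := abs_im_digamma_freq_sub_le ha hn1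
  have hT0 := archExpSumSin_nonneg ha hn1
  have hT := archExpSumSin_le ha hn1
  have hn1' : (1 : ℝ) ≤ n := by exact_mod_cast hn1
  have h1 : a / (π * n) ≤ a / π := by
    apply div_le_div_of_nonneg_left ha.le (by positivity)
    nlinarith [Real.pi_pos]
  have h2 : weilArchDensity (2 * a) * a / (π * n) ≤ weilArchDensity (2 * a) * a / π := by
    apply div_le_div_of_nonneg_left (by positivity) (by positivity)
    nlinarith [Real.pi_pos]
  have e2 : 2 * a / (π * (n : ℝ)) = 2 * (a / (π * n)) := by ring
  rw [e2] at hY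
  generalize (Complex.digamma (1 / 4 + ((freq a n : ℝ) : ℂ) / 2 * I)).im = Y at hY ⊢
  generalize (∑ k ∈ weilPrimeIndex a, (χ (k : ZMod q)).re * ((Λ k : ℝ) / Real.sqrt k) *
    Real.sin (freq a n * Real.log k)) = P at hP ⊢
  generalize (∑ k ∈ weilPrimeIndex a, (Λ k : ℝ) / Real.sqrt k) = L at hP hL ⊢
  generalize archExpSumSin a n = T at hT0 hT ⊢
  have hsplit : a * (1 + weilArchDensity (2 * a)) / π = a / π + weilArchDensity (2 * a) * a / π := by ring
  rw [hsplit]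
  generalize weilArchDensity (2 * a) * a / (π * n) = U at hT h2
  generalize weilArchDensity (2 * a) * a / π = U' at h2 ⊢
  generalize a / (π * n) = A at hY h1
  generalize a / π = A' at h1 ⊢
  rw [abs_le] at hY hP ⊢
  constructor
  · linarith [hY.1, hP.1, hT, h2, h1, Real.pi_pos]
  · linarith [hY.2, hP.2, hT0, h1, h2, hT]

end ModeF

/-! ## The order-`J` remainders -/

section Remainder

/-- **Order-`J` column structure for a character, even sector.**  For `a > 0`, `1 ≤ m`, `2i ≤ m` and every `J`:
`|M⁺_χ(i,m) − (−1)^{i+m}Σ_{j<J}(F^χ_m i^{2j}/(πm^{2j+1}) − F^χ_i i^{2j+1}/(πm^{2j+2}))| ≤ 2C_F i^{2J}/(π m^{2J+1})`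
(no polar term). -/
theorem abs_evenTwistedKernel_col_sub_sum_le (χ : DirichletCharacter ℂ q) (ha : 0 < a) {i m : ℕ} (hm : 1 ≤ m)
    (him : 2 * i ≤ m) (J : ℕ) :
    |(if i = 0 then twistedGramCoeff χ a 0 m else if m = 0 then twistedGramCoeff χ a i 0
        else (twistedGramCoeff χ a i m + twistedGramCoeff χ a i (-(m : ℤ))) / 2)
      - (-1 : ℝ) ^ ((i : ℤ) + m) *
        ∑ j ∈ Finset.range J,
          (((Complex.digamma (1 / 4 + ((freq a m : ℝ) : ℂ) / 2 * I)).im / 2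
              + (∑ k ∈ weilPrimeIndex a,
                  (χ (k : ZMod q)).re * ((Λ k : ℝ) / Real.sqrt k) * Real.sin (freq a m * Real.log k))
              - archExpSumSin a m)
            * (i : ℝ) ^ (2 * j) / (π * (m : ℝ) ^ (2 * j + 1))
          - ((Complex.digamma (1 / 4 + ((freq a i : ℝ) : ℂ) / 2 * I)).im / 2
              + (∑ k ∈ weilPrimeIndex a,
                  (χ (k : ZMod q)).re * ((Λ k : ℝ) / Real.sqrt k) * Real.sin (freq a i * Real.log k))
              - archExpSumSin a i)
            * (i : ℝ) ^ (2 * j + 1) / (π * (m : ℝ) ^ (2 * j + 2)))|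
      ≤ 2 * (π / 4 + (∑ k ∈ weilPrimeIndex a, (Λ k : ℝ) / Real.sqrt k) + a * (1 + weilArchDensity (2 * a)) / π)
          * (i : ℝ) ^ (2 * J) / (π * (m : ℝ) ^ (2 * J + 1)) := by
  have him' : i < m := by omega
  have hm0 : (0 : ℝ) < m := by exact_mod_cast hm
  have hFm := abs_twistedModeF_le χ ha m
  have hFi := abs_twistedModeF_le χ ha i
  rw [evenTwistedKernel_col_eq χ a hm him']
  generalize (Complex.digamma (1 / 4 + ((freq a m : ℝ) : ℂ) / 2 * I)).im / 2
      + (∑ k ∈ weilPrimeIndex a, (χ (k : ZMod q)).re * ((Λ k : ℝ) / Real.sqrt k) * Real.sin (freq a m * Real.log k))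
      - archExpSumSin a m = Fm at hFm ⊢
  generalize (Complex.digamma (1 / 4 + ((freq a i : ℝ) : ℂ) / 2 * I)).im / 2
      + (∑ k ∈ weilPrimeIndex a, (χ (k : ZMod q)).re * ((Λ k : ℝ) / Real.sqrt k) * Real.sin (freq a i * Real.log k))
      - archExpSumSin a i = Fi at hFi ⊢
  have hsum : ∑ j ∈ Finset.range J, (Fm * (i : ℝ) ^ (2 * j) / (π * (m : ℝ) ^ (2 * j + 1))
        - Fi * (i : ℝ) ^ (2 * j + 1) / (π * (m : ℝ) ^ (2 * j + 2)))
      = ((m : ℝ) * Fm - i * Fi) / π * ∑ j ∈ Finset.range J, (i : ℝ) ^ (2 * j) / (m : ℝ) ^ (2 * j + 2) := by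
    rw [Finset.mul_sum]
    exact Finset.sum_congr rfl fun j _ ↦ (even_expansion_term Fm Fi hm0.ne' j).symm
  have e : (-1 : ℝ) ^ ((i : ℤ) + m) * (((m : ℝ) * Fm - i * Fi) / (π * ((m : ℝ) ^ 2 - i ^ 2)))
      - (-1 : ℝ) ^ ((i : ℤ) + m) *
        ∑ j ∈ Finset.range J, (Fm * (i : ℝ) ^ (2 * j) / (π * (m : ℝ) ^ (2 * j + 1))
            - Fi * (i : ℝ) ^ (2 * j + 1) / (π * (m : ℝ) ^ (2 * j + 2)))
      = (-1 : ℝ) ^ ((i : ℤ) + m) * (((m : ℝ) * Fm - i * Fi) / π *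
          (1 / ((m : ℝ) ^ 2 - i ^ 2) - ∑ j ∈ Finset.range J, (i : ℝ) ^ (2 * j) / (m : ℝ) ^ (2 * j + 2))) := by
    rw [hsum, ← div_div]
    ring
  rw [e, abs_mul, abs_neg_one_zpow_natCast_add', one_mul]
  have hX := abs_inv_sq_sub_sq_sub_sum_le (m : ℝ) (i : ℝ) hm0
    (by rw [abs_of_nonneg (Nat.cast_nonneg i)]; exact_mod_cast him) J
  exact (col_remainder_core (Nat.cast_nonneg i) hm0 (by exact_mod_cast him) hFm hFi J hX).1

/-- **Order-`J` column structure for a character, odd sector.**  For `a > 0`, `1 ≤ i`, `2i ≤ m` (modes) and every `J`: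
`|M⁻_χ(i,m) − (−1)^{i+m}Σ_{j<J}(F^χ_m i^{2j+1}/(πm^{2j+2}) − F^χ_i i^{2j}/(πm^{2j+1}))| ≤ 2C_F i^{2J}/(π m^{2J+1})`
(no polar term). -/
theorem abs_oddTwistedKernel_col_sub_sum_le (χ : DirichletCharacter ℂ q) (ha : 0 < a) {i m : ℕ} (hi : 1 ≤ i)
    (him : 2 * i ≤ m) (J : ℕ) :
    |(twistedGramCoeff χ a i m - twistedGramCoeff χ a i (-(m : ℤ))) / 2
      - (-1 : ℝ) ^ ((i : ℤ) + m) *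
        ∑ j ∈ Finset.range J,
          (((Complex.digamma (1 / 4 + ((freq a m : ℝ) : ℂ) / 2 * I)).im / 2
              + (∑ k ∈ weilPrimeIndex a,
                  (χ (k : ZMod q)).re * ((Λ k : ℝ) / Real.sqrt k) * Real.sin (freq a m * Real.log k))
              - archExpSumSin a m)
            * (i : ℝ) ^ (2 * j + 1) / (π * (m : ℝ) ^ (2 * j + 2))
          - ((Complex.digamma (1 / 4 + ((freq a i : ℝ) : ℂ) / 2 * I)).im / 2
              + (∑ k ∈ weilPrimeIndex a,
                  (χ (k : ZMod q)).re * ((Λ k : ℝ) / Real.sqrt k) * Real.sin (freq a i * Real.log k))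
              - archExpSumSin a i)
            * (i : ℝ) ^ (2 * j) / (π * (m : ℝ) ^ (2 * j + 1)))|
      ≤ 2 * (π / 4 + (∑ k ∈ weilPrimeIndex a, (Λ k : ℝ) / Real.sqrt k) + a * (1 + weilArchDensity (2 * a)) / π)
          * (i : ℝ) ^ (2 * J) / (π * (m : ℝ) ^ (2 * J + 1)) := by
  have him' : i < m := by omega
  have hm : 1 ≤ m := by omega
  have hm0 : (0 : ℝ) < m := by exact_mod_cast hm
  have hFm := abs_twistedModeF_le χ ha m
  have hFi := abs_twistedModeF_le χ ha i
  rw [oddTwistedKernel_col_eq χ a hi him']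
  generalize (Complex.digamma (1 / 4 + ((freq a m : ℝ) : ℂ) / 2 * I)).im / 2
      + (∑ k ∈ weilPrimeIndex a, (χ (k : ZMod q)).re * ((Λ k : ℝ) / Real.sqrt k) * Real.sin (freq a m * Real.log k))
      - archExpSumSin a m = Fm at hFm ⊢
  generalize (Complex.digamma (1 / 4 + ((freq a i : ℝ) : ℂ) / 2 * I)).im / 2
      + (∑ k ∈ weilPrimeIndex a, (χ (k : ZMod q)).re * ((Λ k : ℝ) / Real.sqrt k) * Real.sin (freq a i * Real.log k))
      - archExpSumSin a i = Fi at hFi ⊢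
  have hsum : ∑ j ∈ Finset.range J, (Fm * (i : ℝ) ^ (2 * j + 1) / (π * (m : ℝ) ^ (2 * j + 2))
        - Fi * (i : ℝ) ^ (2 * j) / (π * (m : ℝ) ^ (2 * j + 1)))
      = ((i : ℝ) * Fm - m * Fi) / π * ∑ j ∈ Finset.range J, (i : ℝ) ^ (2 * j) / (m : ℝ) ^ (2 * j + 2) := by
    rw [Finset.mul_sum]
    exact Finset.sum_congr rfl fun j _ ↦ (odd_expansion_term Fm Fi hm0.ne' j).symm
  have e : (-1 : ℝ) ^ ((i : ℤ) + m) * (((i : ℝ) * Fm - m * Fi) / (π * ((m : ℝ) ^ 2 - i ^ 2)))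
      - (-1 : ℝ) ^ ((i : ℤ) + m) *
        ∑ j ∈ Finset.range J, (Fm * (i : ℝ) ^ (2 * j + 1) / (π * (m : ℝ) ^ (2 * j + 2))
            - Fi * (i : ℝ) ^ (2 * j) / (π * (m : ℝ) ^ (2 * j + 1)))
      = (-1 : ℝ) ^ ((i : ℤ) + m) * (((i : ℝ) * Fm - m * Fi) / π *
          (1 / ((m : ℝ) ^ 2 - i ^ 2) - ∑ j ∈ Finset.range J, (i : ℝ) ^ (2 * j) / (m : ℝ) ^ (2 * j + 2))) := by
    rw [hsum, ← div_div]
    ring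
  rw [e, abs_mul, abs_neg_one_zpow_natCast_add', one_mul]
  have hX := abs_inv_sq_sub_sq_sub_sum_le (m : ℝ) (i : ℝ) hm0
    (by rw [abs_of_nonneg (Nat.cast_nonneg i)]; exact_mod_cast him) J
  exact (col_remainder_core (Nat.cast_nonneg i) hm0 (by exact_mod_cast him) hFm hFi J hX).2

end Remainder

end Summit.Ventures.WeilGRH

end
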